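import Summits.HodgeConjecture.Ring2.NonSimpleFourfoldsHodge
import Literature.AlgebraicGeometry.HodgeTheory.NoTypeIVTimesCMStablyNondegenerate
import HarnessLib

/-!
# Non-simple complex abelian FIVEFOLDS, part 1: the rows of Moonen–Zarhin 1999 §5 (5.6)–(5.11) with an elliptic factor and pieces of dimension `≤ 2` (Math. Ann. 315, Thm. 0.2 (4))

Cell `pub-hodge-ring2` (HONEST FRAMING: research route conditional on HC_CM; not a corollary; Q11.4-sentence-2 already
refuted in dim ≥ 3), Literature lane (lit seat, generation 59, programme R27 = the FIVEFOLD assembly, sequel of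
`Ring2/NonSimpleFourfoldsHodge` (gen 58, R26)); kernel-target topic directory `Summits/HodgeConjecture/Ring2/`. Theorems
only (no definition, no named fact, no `sorry`); NOTHING here assumes HC_CM. NEW as stated (assemblies of Literature rows
with the gen-58 Summit union), hence under `Summits/`. Part 2 (`Ring2/NonSimpleFivefoldsHodge`) carries the master
theorem «Thm. 0.2 (4) for non-simple fivefolds» and the hypothesis-free shapes.

PUBLISHED STATEMENT. B. Moonen, Yu. Zarhin, *Hodge classes on abelian varieties of low dimension*, Math. Ann. **315**
(1999) 711–733 [corpus: paper:arxiv-math_9901113]. Cases (chunk p0001 L129–L140): «(e) `X` is isogenous to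
`X₁² × X₂` where `X₁` and `X₂` are as in (a)» [(a): `X₁` an elliptic curve with complex multiplication by `k`, `X₂` a
simple abelian threefold with `k ↪ End⁰(X₂)`]; «(f) `X` is isogenous to `X₀ × X₁ × X₂`, where `X₀` is an elliptic
curve, where `X₁` and `X₂` are as in (a), and such that `X₀` and `X₁` are not isogenous»; «(g) `X ∼ X₁ × X₂` where `X₁`
is an elliptic curve with complex multiplication by `k` and `X₂` is a simple abelian fourfold [with] `k ↪ End⁰(X₂)` [of]
multiplicities `(1,3)`». Thm. 0.2 (4) (chunk p0002 L1–L7): «Suppose we are not in one of the cases (e), (f) or (g).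
[…] In particular, if `X` has no simple factor of dimension 4 then `Hg(X) = Sp_D(V,φ)` and `B•(Xⁿ) = D•(Xⁿ)` for every
`n ≥ 1`.» Proof for non-simple fivefolds: §5 (5.6)–(5.11) (chunks p0009 L110–p0010 L90), by `(d₁,d₂) = (dim X₁, dim X₂)`,
`X₁` the maximal abelian subvariety without factors of Type 4: (5.6)–(5.9) by Prop. (3.8), Thm. (3.2), Lemma (3.4);
(5.10)–(5.11) (all factors of Type 4) by Lemma (3.6) / Prop. (3.8) / Galois arguments.

THIS FILE (rows; every decomposition of a fivefold has an elliptic or a surface factor, so the analysis runs on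
`X ∼ E × Z` and `X ∼ S × T`). The tree's rows used BY NAME: `A × E`, `E` WITHOUT complex multiplication, `A` stably
nondegenerate, `Hom(A,E) = 0` (`IsStablyNondegenerate.prod_nonCMCurve_of_forall_hom_eq_zero`,
`isStablyNondegenerate_nonCMCurve_prod_threefold`; Lemma (3.4), R22); `S × Y` for `S` a simple NON-CM surface,
`dim Y ≤ 3` (`isStablyNondegenerate_simpleSurface_prod_of_dim_le_three`; Lemma (3.4) with (2.2), R25); products of
elliptic curves (`isStablyNondegenerate_multiPowSucc`, Cor. (3.9)); every `S₁ × S₂` and every `E × T` with `T`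
non-simple (`Ring2.NonSimpleFourfolds.isStablyNondegenerate_surface_prod_surface`, `…curve_prod_threefold_of_not_isSimple`,
gen 58, unconditional); mixed powers (`IsStablyNondegenerate.powSucc_prod_powSucc`) for isogenous repeated curves.
* §1 `exists_prod_isIsogenous_of_not_isSimple_fivefold` (Poincaré: `(1,4)` or `(2,3)`); domination helpers
  (`avDominatedBy_left/right_of_forall_hom_eq_zero`, `isOfCMType_of_avDominatedBy`, «not (e)/(f)» transport).
* §2 **`isStablyNondegenerate_nonCMCurve_prod_curve_prod_curve_prod_simpleSurface`** — `E × (E₁ × (E₂ × S))` for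
  `E` non-CM, `S` simple: NO further hypothesis; `isStablyNondegenerate_fiveCurves`;
  `…_curve_prod_curve_prod_curve_prod_surface_of_not_isOfCMType` (three curves × any surface, not of CM type);
  **`…_curve_prod_surface_prod_surface_of_not_isOfCMType`** (`E × S₁ × S₂` not of CM type — the CM ones are Summit
  CorCM theorems, assembled in part 2); `…_simpleSurface_prod_threefold_of_not_isOfCMType_of` (`S × T`, `S` simple,
  displays the row (5.10) `hST`; `T × S` row `isStablyNondegenerate_threefold_prod_simpleSurface`, R25, and Thm. (3.2)(2)
  `IsStablyNondegenerate.prod_of_hasNoTypeIVFactor_of_isSimple_of_isOfCMType_of_dim_le_three`, R5); `not_avDominatedBy_curve_prod_surface_prod_surface`.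

## References
* [MoonenZarhin1999LowDim] B. Moonen, Yu. Zarhin, Math. Ann. 315 (1999) 711–733: cases (e)–(g), Thm. 0.2 (chunks
  p0001 L127–L171, p0002 L1–L14), Thm. (3.2), Lemma (3.4), Prop. (3.8), Cor. (3.9) (chunks p0006 L96–p0007 L94),
  §5 (5.6)–(5.11) (chunks p0009 L110–p0010 L90) [corpus: paper:arxiv-math_9901113]. [cite: MoonenZarhin1999LowDim, Thm. 0.2 (4) and §5 (5.6)–(5.11)]
* [MumfordAV1970] D. Mumford, *Abelian Varieties* (1970), §19 Thm. 1 and Cor. 1–2 (pp. 173–174). [cite: MumfordAV1970, §19 Thm. 1 (pp. 173–174)]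
* [vanGeemen1994HodgeAV] B. van Geemen, LNM 1594 (1994), §3.6, Lemma 3.7, Thm. 4.3. [cite: vanGeemen1994HodgeAV, Lemma 3.7 and §3.6]
* [Milne1999] J. S. Milne, Compositio Math. 117 (1999), §2 p. 54 (CM type and isogeny factors). [cite: Milne1999, §2 p. 54]
-/

noncomputable section

open CategoryTheory CategoryTheory.Limits

namespace Summit.HodgeConjecture.Ring2.NonSimpleFivefolds

open Literature.AlgebraicGeometry.Motives (AbelianVariety)
open Literature.AlgebraicGeometry.Motives.AbelianVariety
open Literature.AlgebraicGeometry.HodgeTheory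
open Literature.AlgebraicGeometry.Milne1999
open Summit.HodgeConjecture.CorCM
open Summit.HodgeConjecture.CorCM.Domination
open Summit.HodgeConjecture.Ring2.NonSimpleFourfolds

variable {X Y Z E E' E₁ E₂ E₃ E₄ E₅ T S S₁ S₂ : AbelianVariety ℂ}

/-! ### §1 Poincaré for fivefolds; domination helpers -/

/-- **A non-simple complex abelian fivefold is isogenous to `Y × Z` with `(dim Y, dim Z) = (1,4)` or `(2,3)`**
(Poincaré's complete reducibility: an abelian subvariety `B ↪ X`, `0 < dim B < 5`, and its complement; if `dim B ≥ 3`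
use the complement of the complement). [cite: MumfordAV1970, §19 Thm. 1 (pp. 173–174)] [cite: MoonenZarhin1999LowDim, §5 (5.6)–(5.11)] -/
theorem exists_prod_isIsogenous_of_not_isSimple_fivefold (hX5 : X.dim = 5) (hX : ¬ X.IsSimple) :
    ∃ Y Z : AbelianVariety ℂ, (Y.dim = 1 ∧ Z.dim = 4 ∨ Y.dim = 2 ∧ Z.dim = 3) ∧
      AbelianVariety.IsIsogenous (Y.prod Z) X := by
  obtain ⟨B, f, hf, hB0, hBX⟩ := exists_abelianSubvariety_of_not_isSimple hX
  haveI := hf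
  obtain ⟨Z, j, hj, hσ⟩ := poincare_complete_reducibility f
  haveI := hj
  have hdim : B.dim + Z.dim = X.dim := by
    rw [← dim_prod, ← dim_eq_of_isIsogeny (isIsogeny_hom_of_iso (biprodIsoProd B Z)), dim_eq_of_isIsogeny hσ]
  rcases Nat.lt_or_ge B.dim 3 with hB12 | hB3
  · refine ⟨B, Z, by omega, (biprodIsoProd B Z).inv ≫ biprod.desc f j, ?_⟩
    exact isIsogeny_comp (isIsogeny_hom_of_iso (biprodIsoProd B Z).symm) hσ
  · obtain ⟨Z', j', -, hσ'⟩ := poincare_complete_reducibility j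
    have hdim' : Z.dim + Z'.dim = X.dim := by
      rw [← dim_prod, ← dim_eq_of_isIsogeny (isIsogeny_hom_of_iso (biprodIsoProd Z Z')), dim_eq_of_isIsogeny hσ']
    refine ⟨Z, Z', by omega, (biprodIsoProd Z Z').inv ≫ biprod.desc j j', ?_⟩
    exact isIsogeny_comp (isIsogeny_hom_of_iso (biprodIsoProd Z Z').symm) hσ'

/-- `A × (B × C) ∼ B × (A × C)`. [cite: MumfordAV1970, §19 (p. 169)] -/
theorem isIsogenous_prod_leftComm (A B C : AbelianVariety ℂ) :
    AbelianVariety.IsIsogenous (A.prod (B.prod C)) (B.prod (A.prod C)) :=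
  (isIsogenous_prod_assoc A B C).symm'.trans (isIsogenous_prodRotate A B C)

/-- An isogeny factor `S` of `A × B` with `Hom(S, B) = 0` is an isogeny factor of `A` (the section `s : S → A × B` has
zero second component, so `s = s₁ ≫ (𝟙, 0)` and `s₁ ≫ ((𝟙,0) ≫ π) = [N]`). [cite: MumfordAV1970, §19 Thm. 1 and Cor. 1 (pp. 173–174)] -/
theorem avDominatedBy_left_of_forall_hom_eq_zero {A B : AbelianVariety ℂ} (h : AVDominatedBy S (A.prod B))
    (hSB : ∀ f : S ⟶ B, f = 0) : AVDominatedBy S A := by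
  obtain ⟨s, π, N, hN, hsπ⟩ := h
  refine ⟨s ≫ AbelianVariety.fst A B, AbelianVariety.prodLift (𝟙 A) 0 ≫ π, N, hN, ?_⟩
  have hs : s = (s ≫ AbelianVariety.fst A B) ≫ AbelianVariety.prodLift (𝟙 A) 0 := by
    apply prod_hom_ext
    · rw [Category.assoc, prodLift_fst, Category.comp_id]
    · rw [Category.assoc, prodLift_snd, comp_zero, hSB (s ≫ AbelianVariety.snd A B)]
  rw [← Category.assoc, ← hs, hsπ]

/-- An isogeny factor `S` of `A × B` with `Hom(S, A) = 0` is an isogeny factor of `B`. [cite: MumfordAV1970, §19 Thm. 1 and Cor. 1 (pp. 173–174)] -/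
theorem avDominatedBy_right_of_forall_hom_eq_zero {A B : AbelianVariety ℂ} (h : AVDominatedBy S (A.prod B))
    (hSA : ∀ f : S ⟶ A, f = 0) : AVDominatedBy S B := by
  obtain ⟨s, π, N, hN, hsπ⟩ := h
  refine ⟨s ≫ AbelianVariety.snd A B, AbelianVariety.prodLift 0 (𝟙 B) ≫ π, N, hN, ?_⟩
  have hs : s = (s ≫ AbelianVariety.snd A B) ≫ AbelianVariety.prodLift 0 (𝟙 B) := by
    apply prod_hom_ext
    · rw [Category.assoc, prodLift_fst, comp_zero, hSA (s ≫ AbelianVariety.fst A B)]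
    · rw [Category.assoc, prodLift_snd, Category.comp_id]
  rw [← Category.assoc, ← hs, hsπ]

/-- Homomorphisms into a product vanish when both components vanish. [cite: MumfordAV1970, §19 (p. 169)] -/
theorem hom_prod_eq_zero_of_forall {A B : AbelianVariety ℂ} (h₁ : ∀ f : S ⟶ A, f = 0) (h₂ : ∀ g : S ⟶ B, g = 0)
    (u : S ⟶ A.prod B) : u = 0 :=
  prod_hom_ext (by rw [zero_comp]; exact h₁ _) (by rw [zero_comp]; exact h₂ _)

/-- **An isogeny factor of an abelian variety of CM type is of CM type** (Milne: quotients of CM abelian varieties are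
CM; `s ≫ π = [N]` makes `π` surjective). [cite: Milne1999, §2 p. 54] [cite: MumfordAV1970, §19 Thm. 1 (pp. 173–174)] -/
theorem isOfCMType_of_avDominatedBy (hX : IsOfCMType X) (h : AVDominatedBy E X) : IsOfCMType E := by
  obtain ⟨s, π, N, hN, hsπ⟩ := h
  exact hX.of_comp_eq_nsmul_id s π hN hsπ

/-- Two elliptic curves with a non-zero homomorphism between them are isogenous. [cite: MumfordAV1970, §19 Cor. 2 of Thm. 1 (p. 174)] -/
theorem isIsogenous_of_hom_ne_zero_of_curves (hE' : E'.dim = 1) (hE : E.dim = 1) {f : E' ⟶ E} (hf : f ≠ 0) :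
    AbelianVariety.IsIsogenous E' E :=
  ⟨f, isIsogeny_of_isSimple_of_ne_zero (isSimple_of_dim_le_one hE'.le) (isSimple_of_dim_le_one hE.le) f hf⟩

/-- A homomorphism from an elliptic curve WITHOUT complex multiplication to one OF CM type vanishes (a non-zero one
would be an isogeny, and CM type is an isogeny invariant). [cite: Milne1999, §2 p. 54] [cite: MumfordAV1970, §19 Cor. 2 of Thm. 1 (p. 174)] -/
theorem hom_eq_zero_of_not_isOfCMType_of_isOfCMType_curves (hE : E.dim = 1) (hE' : E'.dim = 1)
    (hEcm : ¬ IsOfCMType E) (hE'cm : IsOfCMType E') (f : E ⟶ E') : f = 0 := by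
  by_contra hf
  exact hEcm ((isOfCMType_iff_of_isIsogenous (isIsogenous_of_hom_ne_zero_of_curves hE hE' hf)).2 hE'cm)

/-- «Not (e)/(f)» relative to `X` passes to every isogeny factor `W` of `X` (domination is transitive). [cite: MumfordAV1970, §19 Thm. 1 (pp. 173–174)] -/
theorem not_exists_caseEF_of_avDominatedBy {W : AbelianVariety ℂ} (hWX : AVDominatedBy W X)
    (hna : ¬ ∃ E T : AbelianVariety ℂ, E.dim = 1 ∧ IsOfCMType E ∧ T.IsSimple ∧ T.dim = 3 ∧
      AVDominatedBy E X ∧ AVDominatedBy T X ∧ Nonempty (E.endAlgebra →+* T.endAlgebra)) :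
    ¬ ∃ E T : AbelianVariety ℂ, E.dim = 1 ∧ IsOfCMType E ∧ T.IsSimple ∧ T.dim = 3 ∧
      AVDominatedBy E W ∧ AVDominatedBy T W ∧ Nonempty (E.endAlgebra →+* T.endAlgebra) := by
  rintro ⟨E, T, hE, hEcm, hTs, hT3, hEW, hTW, hne⟩
  exact hna ⟨E, T, hE, hEcm, hTs, hT3, hEW.trans hWX, hTW.trans hWX, hne⟩

/-- «Not (e)/(f)» gives, for an elliptic curve `E` and a simple threefold `T` dominated by `X`, the printed
non-embedding `End⁰(E) ↪̸ End⁰(T)` as soon as `E` has complex multiplication — the hypothesis of the tree's complete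
`E × T` row. [cite: MoonenZarhin1999LowDim, Thm. 0.2 (e), (f) and Prop. (3.8)] -/
theorem isEmpty_ringHom_of_not_exists_caseEF (hE : E.dim = 1) (hTs : T.IsSimple) (hT3 : T.dim = 3)
    (hEX : AVDominatedBy E X) (hTX : AVDominatedBy T X)
    (hna : ¬ ∃ E T : AbelianVariety ℂ, E.dim = 1 ∧ IsOfCMType E ∧ T.IsSimple ∧ T.dim = 3 ∧
      AVDominatedBy E X ∧ AVDominatedBy T X ∧ Nonempty (E.endAlgebra →+* T.endAlgebra)) :
    IsOfCMType E → IsEmpty (E.endAlgebra →+* T.endAlgebra) := by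
  intro hEcm
  by_contra hne
  rw [not_isEmpty_iff] at hne
  exact hna ⟨E, T, hE, hEcm, hTs, hT3, hEX, hTX, hne⟩

/-! ### §2 The rows -/

/-- **Products of five elliptic curves are stably nondegenerate** (multi-curve slots; Cor. (3.9) / van Geemen Thm. 4.3
stably). [cite: MoonenZarhin1999LowDim, Cor. (3.9)] [cite: vanGeemen1994HodgeAV, Thm. 4.3] -/
theorem isStablyNondegenerate_fiveCurves (h₁ : E₁.dim = 1) (h₂ : E₂.dim = 1) (h₃ : E₃.dim = 1) (h₄ : E₄.dim = 1)
    (h₅ : E₅.dim = 1) : IsStablyNondegenerate ((((E₁.prod E₂).prod E₃).prod E₄).prod E₅) := by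
  have h := isStablyNondegenerate_multiPowSucc 4 ![E₁, E₂, E₃, E₄, E₅] (fun _ => 0)
    (fun i => by fin_cases i <;> simp [h₁, h₂, h₃, h₄, h₅])
  exact h

/-- The same in the right-nested shape `E₁ × (E₂ × (E₃ × (E₄ × E₅)))`. [cite: MoonenZarhin1999LowDim, Cor. (3.9)] -/
theorem isStablyNondegenerate_fiveCurves' (h₁ : E₁.dim = 1) (h₂ : E₂.dim = 1) (h₃ : E₃.dim = 1) (h₄ : E₄.dim = 1)
    (h₅ : E₅.dim = 1) : IsStablyNondegenerate (E₁.prod (E₂.prod (E₃.prod (E₄.prod E₅)))) :=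
  (((isStablyNondegenerate_fiveCurves h₁ h₂ h₃ h₄ h₅).of_isIsogenous'
    (isIsogenous_prod_assoc ((E₁.prod E₂).prod E₃) E₄ E₅)).of_isIsogenous'
    (isIsogenous_prod_assoc (E₁.prod E₂) E₃ (E₄.prod E₅))).of_isIsogenous' (isIsogenous_prod_assoc E₁ E₂ _)

/-- **`E × (E₁ × (E₂ × S))` is stably nondegenerate for `E` an elliptic curve WITHOUT complex multiplication, `E₁`,
`E₂` any elliptic curves and `S` any SIMPLE abelian surface** — no further hypothesis. The cofactor `E₁ × (E₂ × S)` is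
stably nondegenerate (gen 58: `E₁ ×` a non-simple threefold); if `Hom(E₁ × E₂ × S, E) = 0` this is the `A × E` row
(Lemma (3.4)); if `Eᵢ ∼ E` then `X ∼ E² × (E_j × S)`, mixed powers of the fourfold `E × (E_j × S)` (Lemma (3.4) for
`E ×` any threefold). [cite: MoonenZarhin1999LowDim, §5 (5.6), (5.9), Lemma (3.4) and Prop. (3.8)]
[cite: vanGeemen1994HodgeAV, Lemma 3.7 and §3.6] -/
theorem isStablyNondegenerate_nonCMCurve_prod_curve_prod_curve_prod_simpleSurface (hE : E.dim = 1)
    (hEend : Module.finrank ℚ E.endAlgebra = 1) (h₁ : E₁.dim = 1) (h₂ : E₂.dim = 1) (hS : S.IsSimple)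
    (hS2 : S.dim = 2) : IsStablyNondegenerate (E.prod (E₁.prod (E₂.prod S))) := by
  have hEs : E.IsSimple := isSimple_of_dim_le_one hE.le
  have hSE : ∀ g : S ⟶ E, g = 0 := hom_eq_zero_of_isSimple_of_dim_ne hS hEs (by omega)
  by_cases h1E : ∀ f : E₁ ⟶ E, f = 0
  · by_cases h2E : ∀ f : E₂ ⟶ E, f = 0
    · -- `Hom(E₁ × (E₂ × S), E) = 0`: the `A × E` row with `A = E₁ × (E₂ × S)` stably nondegenerate
      have hW : IsStablyNondegenerate (E₁.prod (E₂.prod S)) :=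
        isStablyNondegenerate_curve_prod_threefold_of_not_isSimple h₁ (by rw [dim_prod]; omega)
          (not_isSimple_prod_of_dim_pos (by omega) (by omega))
      exact (hW.prod_nonCMCurve_of_forall_hom_eq_zero hE hEend
        (prod_hom_eq_zero_of_forall h1E (prod_hom_eq_zero_of_forall h2E hSE))).of_isIsogenous'
        (isIsogenous_prod_comm _ E)
    · -- `E₂ ∼ E`: `X ∼ E² × (E₁ × S)`
      push Not at h2E
      obtain ⟨f, hf⟩ := h2E
      have h2iso := isIsogenous_of_hom_ne_zero_of_curves h₂ hE hf
      have hD : IsStablyNondegenerate ((E.powSucc 1).prod ((E₁.prod S).powSucc 0)) :=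
        (isStablyNondegenerate_nonCMCurve_prod_threefold (T := E₁.prod S) (by rw [dim_prod]; omega) hE
          hEend).powSucc_prod_powSucc 1 0
      change IsStablyNondegenerate ((E.prod E).prod (E₁.prod S)) at hD
      exact (hD.of_isIsogenous' (isIsogenous_prod_assoc E E (E₁.prod S))).of_isIsogenous
        ((AbelianVariety.IsIsogenous.refl E).prod ((isIsogenous_prod_leftComm E₁ E₂ S).trans
          (h2iso.prod (AbelianVariety.IsIsogenous.refl _))))
  · -- `E₁ ∼ E`: `X ∼ E² × (E₂ × S)`
    push Not at h1E
    obtain ⟨f, hf⟩ := h1E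
    have h1iso := isIsogenous_of_hom_ne_zero_of_curves h₁ hE hf
    have hD : IsStablyNondegenerate ((E.powSucc 1).prod ((E₂.prod S).powSucc 0)) :=
      (isStablyNondegenerate_nonCMCurve_prod_threefold (T := E₂.prod S) (by rw [dim_prod]; omega) hE
        hEend).powSucc_prod_powSucc 1 0
    change IsStablyNondegenerate ((E.prod E).prod (E₂.prod S)) at hD
    exact (hD.of_isIsogenous' (isIsogenous_prod_assoc E E (E₂.prod S))).of_isIsogenous
      ((AbelianVariety.IsIsogenous.refl E).prod (h1iso.prod (AbelianVariety.IsIsogenous.refl _)))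

/-- **`E × (E₁ × (E₂ × S))` for three elliptic curves and ANY abelian surface `S`, the product NOT of CM type, is
stably nondegenerate** (`S` non-simple: five elliptic curves; `S` simple non-CM: the `Y × S` row, `dim Y = 3`; `S` simple
CM: some curve is non-CM, and the previous theorem after a shuffle). [cite: MoonenZarhin1999LowDim, §5 (5.6)–(5.9), (5.11) and Cor. (3.9)]
[cite: Milne1999, §2 p. 54] -/
theorem isStablyNondegenerate_curve_prod_curve_prod_curve_prod_surface_of_not_isOfCMType (hE : E.dim = 1)
    (h₁ : E₁.dim = 1) (h₂ : E₂.dim = 1) (hS2 : S.dim = 2) (hcm : ¬ IsOfCMType (E.prod (E₁.prod (E₂.prod S)))) :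
    IsStablyNondegenerate (E.prod (E₁.prod (E₂.prod S))) := by
  by_cases hS : S.IsSimple
  swap
  · -- `S ∼ E₃ × E₄`: five elliptic curves
    obtain ⟨E₃, E₄, h₃, h₄, hSiso⟩ := exists_curve_prod_curve_isIsogenous_of_not_isSimple_surface hS2 hS
    exact (isStablyNondegenerate_fiveCurves' hE h₁ h₂ h₃ h₄).of_isIsogenous'
      ((AbelianVariety.IsIsogenous.refl E).prod ((AbelianVariety.IsIsogenous.refl E₁).prod
        ((AbelianVariety.IsIsogenous.refl E₂).prod hSiso)))
  by_cases hScm : IsOfCMType S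
  swap
  · -- `S` simple, not of CM type: `S × (E × (E₁ × E₂))`
    have hD : IsStablyNondegenerate (S.prod (E.prod (E₁.prod E₂))) :=
      isStablyNondegenerate_simpleSurface_prod_of_dim_le_three hS hS2 hScm (by rw [dim_prod]; omega)
        (by rw [dim_prod, dim_prod]; omega)
    exact ((hD.of_isIsogenous' (isIsogenous_prod_comm S _)).of_isIsogenous'
      (isIsogenous_prod_assoc E (E₁.prod E₂) S)).of_isIsogenous'
      ((AbelianVariety.IsIsogenous.refl E).prod (isIsogenous_prod_assoc E₁ E₂ S))
  by_cases hEcm : IsOfCMType E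
  · by_cases h1cm : IsOfCMType E₁
    · by_cases h2cm : IsOfCMType E₂
      · exact absurd (hEcm.prod (h1cm.prod (h2cm.prod hScm))) hcm
      · -- `E₂` non-CM: `E₂ × (E × (E₁ × S))`, shuffled
        exact ((isStablyNondegenerate_nonCMCurve_prod_curve_prod_curve_prod_simpleSurface h₂
          (finrank_endAlgebra_eq_one_of_curve_of_not_isOfCMType h₂ h2cm) hE h₁ hS hS2).of_isIsogenous'
          (isIsogenous_prod_leftComm E₂ E (E₁.prod S))).of_isIsogenous'
          ((AbelianVariety.IsIsogenous.refl E).prod (isIsogenous_prod_leftComm E₂ E₁ S))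
    · -- `E₁` non-CM: `E₁ × (E × (E₂ × S))`, shuffled
      exact (isStablyNondegenerate_nonCMCurve_prod_curve_prod_curve_prod_simpleSurface h₁
        (finrank_endAlgebra_eq_one_of_curve_of_not_isOfCMType h₁ h1cm) hE h₂ hS hS2).of_isIsogenous'
        (isIsogenous_prod_leftComm E₁ E (E₂.prod S))
  · exact isStablyNondegenerate_nonCMCurve_prod_curve_prod_curve_prod_simpleSurface hE
      (finrank_endAlgebra_eq_one_of_curve_of_not_isOfCMType hE hEcm) h₁ h₂ hS hS2

/-- **`E × (S₁ × S₂)` for an elliptic curve and two abelian surfaces, the product NOT of CM type, is stably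
nondegenerate** (a non-simple `Sᵢ ∼ E₁ × E₂`: the previous theorem; both simple: `E` non-CM ⟹ `Hom(S₁ × S₂, E) = 0` and
the `A × E` row over `S₁ × S₂` (stably nondegenerate, gen 58); `E` CM ⟹ some `Sᵢ` is simple non-CM, the `S × Y` row
with `dim Y = 3`). [cite: MoonenZarhin1999LowDim, §5 (5.6)–(5.9), (5.11), Lemma (3.4)] [cite: Milne1999, §2 p. 54] -/
theorem isStablyNondegenerate_curve_prod_surface_prod_surface_of_not_isOfCMType (hE : E.dim = 1) (h₁ : S₁.dim = 2)
    (h₂ : S₂.dim = 2) (hcm : ¬ IsOfCMType (E.prod (S₁.prod S₂))) : IsStablyNondegenerate (E.prod (S₁.prod S₂)) := by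
  have hEs : E.IsSimple := isSimple_of_dim_le_one hE.le
  by_cases hs₁ : S₁.IsSimple
  swap
  · obtain ⟨E₁, E₂, hE₁, hE₂, hS₁iso⟩ := exists_curve_prod_curve_isIsogenous_of_not_isSimple_surface h₁ hs₁
    have hrel : AbelianVariety.IsIsogenous (E.prod (E₁.prod (E₂.prod S₂))) (E.prod (S₁.prod S₂)) :=
      (AbelianVariety.IsIsogenous.refl E).prod (((isIsogenous_prod_assoc E₁ E₂ S₂).symm').trans
        (hS₁iso.prod (AbelianVariety.IsIsogenous.refl S₂)))
    exact (isStablyNondegenerate_curve_prod_curve_prod_curve_prod_surface_of_not_isOfCMType hE hE₁ hE₂ h₂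
      (fun h => hcm ((isOfCMType_iff_of_isIsogenous hrel).1 h))).of_isIsogenous' hrel
  by_cases hs₂ : S₂.IsSimple
  swap
  · obtain ⟨E₁, E₂, hE₁, hE₂, hS₂iso⟩ := exists_curve_prod_curve_isIsogenous_of_not_isSimple_surface h₂ hs₂
    have hrel : AbelianVariety.IsIsogenous (E.prod (E₁.prod (E₂.prod S₁))) (E.prod (S₁.prod S₂)) :=
      (AbelianVariety.IsIsogenous.refl E).prod ((((isIsogenous_prod_assoc E₁ E₂ S₁).symm').trans
        (isIsogenous_prod_comm _ S₁)).trans ((AbelianVariety.IsIsogenous.refl S₁).prod hS₂iso))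
    exact (isStablyNondegenerate_curve_prod_curve_prod_curve_prod_surface_of_not_isOfCMType hE hE₁ hE₂ h₁
      (fun h => hcm ((isOfCMType_iff_of_isIsogenous hrel).1 h))).of_isIsogenous' hrel
  -- both surfaces simple
  by_cases hEcm : IsOfCMType E
  swap
  · have hSS : IsStablyNondegenerate (S₁.prod S₂) := isStablyNondegenerate_surface_prod_surface h₁ h₂
    exact (hSS.prod_nonCMCurve_of_forall_hom_eq_zero hE (finrank_endAlgebra_eq_one_of_curve_of_not_isOfCMType hE hEcm)
      (prod_hom_eq_zero_of_forall (hom_eq_zero_of_isSimple_of_dim_ne hs₁ hEs (by omega))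
        (hom_eq_zero_of_isSimple_of_dim_ne hs₂ hEs (by omega)))).of_isIsogenous' (isIsogenous_prod_comm _ E)
  by_cases hc₁ : IsOfCMType S₁
  · by_cases hc₂ : IsOfCMType S₂
    · exact absurd (hEcm.prod (hc₁.prod hc₂)) hcm
    · -- `S₂` simple non-CM: `S₂ × (E × S₁)`
      have hD : IsStablyNondegenerate (S₂.prod (E.prod S₁)) :=
        isStablyNondegenerate_simpleSurface_prod_of_dim_le_three hs₂ h₂ hc₂ (by rw [dim_prod]; omega)
          (by rw [dim_prod]; omega)
      exact (hD.of_isIsogenous' (isIsogenous_prod_leftComm S₂ E S₁)).of_isIsogenous'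
        ((AbelianVariety.IsIsogenous.refl E).prod (isIsogenous_prod_comm S₂ S₁))
  · -- `S₁` simple non-CM: `S₁ × (E × S₂)`
    have hD : IsStablyNondegenerate (S₁.prod (E.prod S₂)) :=
      isStablyNondegenerate_simpleSurface_prod_of_dim_le_three hs₁ h₁ hc₁ (by rw [dim_prod]; omega)
        (by rw [dim_prod]; omega)
    exact hD.of_isIsogenous' (isIsogenous_prod_leftComm S₁ E S₂)

/-- A simple abelian variety of dimension `≥ 3` is not an isogeny factor of `E × (S₁ × S₂)` (`dim E = 1`,
`dim Sᵢ = 2`): all homomorphisms from the pieces into it vanish by dimension. [cite: MumfordAV1970, §19 Thm. 1 and Cor. 2 (pp. 173–174)] -/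
theorem not_avDominatedBy_curve_prod_surface_prod_surface {F : AbelianVariety ℂ} (hE : E.dim = 1) (h₁ : S₁.dim = 2)
    (h₂ : S₂.dim = 2) (hFs : F.IsSimple) (hF3 : 3 ≤ F.dim) : ¬ AVDominatedBy F (E.prod (S₁.prod S₂)) :=
  not_avDominatedBy_of_forall_hom_eq_zero (T := F) (by omega) fun π =>
    prod_hom_eq_zero_of_forall (fun f => hom_eq_zero_of_isSimple_of_dim_lt hFs (by omega) f)
      (fun u => prod_hom_eq_zero_of_forall (fun f => hom_eq_zero_of_isSimple_of_dim_lt hFs (by omega) f)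
        (fun f => hom_eq_zero_of_isSimple_of_dim_lt hFs (by omega) f) u) π

/-- **`S × T` for a SIMPLE surface `S` and ANY threefold `T`, the product NOT of CM type, is stably nondegenerate —
GIVEN the row (5.10)** (`hST`, asked only for `T` with a factor of Type IV and not of CM type): `S` non-CM ⟹ the `T × S`
row (Lemma (3.4) with (2.2)); `S` CM and `T` without factor of Type IV ⟹ Thm. (3.2)(2) (`T` satisfies (D), dimension
`3`); `T` CM ⟹ the product would be CM; else `hST`.
[cite: MoonenZarhin1999LowDim, §5 (5.6)–(5.8), (5.10), Thm. (3.2)(2), Lemmas (3.4), (3.6)] [cite: Milne1999, §2 p. 54] -/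
theorem isStablyNondegenerate_simpleSurface_prod_threefold_of_not_isOfCMType_of (hS2 : S.dim = 2)
    (hS : S.IsSimple) (hT3 : T.dim = 3) (hcm : ¬ IsOfCMType (S.prod T))
    (hST : ¬ IsOfCMType T → ¬ HasNoTypeIVFactor T → IsOfCMType S → IsStablyNondegenerate (S.prod T)) :
    IsStablyNondegenerate (S.prod T) := by
  by_cases hScm : IsOfCMType S
  swap
  · exact (isStablyNondegenerate_threefold_prod_simpleSurface hT3 hS hS2 hScm).of_isIsogenous' (isIsogenous_prod_comm T S)
  by_cases hT4 : HasNoTypeIVFactor T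
  · exact ((isStablyNondegenerate_of_dim_pos_of_dim_le_three (X := T) (by omega)
      hT3.le).prod_of_hasNoTypeIVFactor_of_isSimple_of_isOfCMType_of_dim_le_three hT4 hS (by omega) (by omega)
      hScm).of_isIsogenous' (isIsogenous_prod_comm T S)
  by_cases hTcm : IsOfCMType T
  · exact absurd (hScm.prod hTcm) hcm
  exact hST hTcm hT4 hScm

end Summit.HodgeConjecture.Ring2.NonSimpleFivefolds
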